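import Summits.BirchSwinnertonDyer.BirchSwinnertonDyer.Theorems.AdditiveKolyvaginRoadBottomRankOneAdditiveClassOfPoint
import Summits.BirchSwinnertonDyer.BirchSwinnertonDyer.Theorems.SchneiderFreeAdditiveX3BranchIMCKrizLiLocus
import Summits.BirchSwinnertonDyer.Rank1Residual.O5.HeegnerLogTransportThreeKrizLiGlue
import Summits.BirchSwinnertonDyer.Rank1Residual.Additive.LocalLogImageRat
import Summits.BirchSwinnertonDyer.Rank1Residual.X11b.BDPRouteOnTreeStepL
import Literature.NumberTheory.EllipticCurves.KrizLi2019.HeegnerLogCongruence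
import Literature.NumberTheory.EllipticCurves.KrausOesterle1992.TraceCongruenceOfTorsionIsoProofs
import Literature.NumberTheory.EllipticCurves.McCallum1991.DivisibilityDescent
import Literature.NumberTheory.EllipticCurves.PastenValuationProductThm115Proofs
import Literature.NumberTheory.EllipticCurves.TamagawaNeZeroProofs
import HarnessLib

/-!
# Route `AdditiveKolyvaginRoad`, crux KS′ `LevelKolyvaginSystemsAdditive` (item stmt-BirchSwinnertonDyer-21396):
# the BOTTOM TRANSFER at conductor ONE through Kriz–Li's logarithm congruence — E-side glue for stub (A2)
# `stub_bottomTransfer` of line `epsilon_matched_retyping`, sub-row (γ)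
# (cell `pub/bsd-wall`, width seat `bsd-wall-akr-p2x-w3` g4; `--supports stmt-BirchSwinnertonDyer-21396`, helper)

WHY. Line `epsilon_matched_retyping` rebuilds the crux on an avatar frame `(E, E₀, p)` — `E` additive at `p`, `E₀` a
`p`-good ordinary curve with `E[p] ≅ E₀[p]` — and its open stub (A2) `stub_bottomTransfer` must carry Kolyvagin
non-vanishing mod `p` from `E₀` to `E`. Its sub-row (γ) («citation-only: `m = 1`, Zhang Thm. 7.2 for `E₀` + `hKL`») is the
conductor-ONE case read through Kriz–Li's Theorem 1.16: the normalised `p`-adic logarithms of the Heegner points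
`y_K ∈ E(K)`, `y_K⁰ ∈ E₀(K)` are congruent mod `p` up to sign. THIS FILE proves the E-side of that sub-row, with NO
`K_𝔭 ≃ ℚ_p` bridge (Kriz–Li is typed along an embedding `ιp : K →+* ℚ_p`):

* §1 `not_dvd_localTamagawaNumber_padic_of_addv_of_five_le'`, `norm_padicLog_le_one_of_addv` — at an ADDITIVE `p ≥ 5`
  one has `p ∤ c_p` (Kodaira–Néron `c_p ≤ 4`), hence `log_ω(E(ℚ_p)) = p^t ℤ_p ⊆ ℤ_p` (the tree's
  `range_padicLog_baseChange_of_addv_of_not_dvd`): the `ℤ_p`-linear logarithm is INTEGRAL on all of `E(ℚ_p)`;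
  `one_le_padicLogOrd_of_zsmul_eq` — so a point `P = p·Q` of `E(K)` of infinite order has `ord_p log_ω P ≥ 1`.
* §2 `eulerFactorOrd_nonneg_of_addv` — Kriz–Li's Euler-type exponent `ord_p ∏_{ℓ ∣ pNN₀/M} |Ẽ^{ns}(𝔽_ℓ)|/ℓ` is `≥ 0` on the
  `E`-side (`|Ẽ^{ns}(𝔽_p)| = p` at an additive `p` — the SchneiderFree cell's `nsPointCount_eq_self_of_addv` —, every other
  term is a `p`-adic valuation);
  `padicLogOrd_le_zero_of_thm116` — hence, by the registry's valuation corollary of Thm. 1.16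
  (`eulerFactorOrd_add_padicLogOrd_sub_eq_zero_iff_of_thm116`) fed with the trace congruence off `pNN₀` that the torsion
  isomorphism gives (Kraus–Oesterlé Prop. 3, PROVED in the tree), the LENDER LOG-UNIT
  «`ord_p(∏|Ẽ₀^{ns}|/ℓ) + ord_p log_{ω₀} y_K⁰ − ord_p c₀ = 0`» forces `ord_p log_ω y_K ≤ ord_p c = 0`.
* §3 `exists_heegnerPoint_over_derivedPoint_one` — the Heegner point `y_K ∈ E(K)` under `P(1)` realises
  `heegnerPointComplex Dt H` for the FRAME's parametrisation datum `Dt` (the tree's `exists_isHeegnerPoint_map_eq_derivedPoint_one`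
  hides `Dt` behind `∃`; Kriz–Li needs it by name, for `p ∤ c_Manin(Dt)`);
  `kolyvaginClass_one_ne_zero_of_thm116` — **THE (γ) TRANSFER**: on the frame (analytic rank one, so `y_K` has infinite order
  by Gross–Zagier + modularity, BY NAME), `hKL` ∧ torsion iso ∧ lender log-unit ⟹ `c_E(1) = d.kolyvaginClass _ 1 ≠ 0` for EVERY
  conductor-one Kolyvagin–Heegner datum `d` (`c(1) ≠ 0 ↔ y_K ∉ pE(K)`, the tree's
  `kolyvaginClass_one_ne_zero_iff_not_exists_zsmul_eq`); `exists_kolyvaginClass_ne_zero_of_thm116` — the same in the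
  conclusion shape of `stub_bottomTransfer` (`∃ m d, …` with `m = ∅`).

HONEST FRAMING: theorems only; 0 definitions, 0 named facts, 0 `sorry`. CONDITIONAL on the named facts it takes BY NAME
(`KrizLi2019.thm116_padicLogHeegner_congruence`, `gross_zagier`, `hasEntireLFunction_rat`) and on the LENDER LOG-UNIT
hypothesis (the `K`-half: Zhang 2014 for `E₀` plus lossless localisation at `𝔭`), spelled inline. Closes nothing by itself;
KS′ is not proved here and BSD is NOT proved by any of this.

References: [cite: KrizLi2019, Thm. 1.16, Rem. 1.17, sentence after Rem. 1.19] [cite: KrausOesterle1992, §3 Prop. 3]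
[cite: GrossLMS1991, §4 (4.4), Prop. 3.6] [cite: McCallumLMS1991, Cor. 4.5] [cite: SilvermanAEC2009, IV.6.4, VII.6.1–6.3]
[cite: SilvermanATAEC1994, Cor. IV.9.2 (d)] [cite: WZhang2014, Thm. 7.2, Thm. 9.3].
-/

-- single-conjunct summit: `Summit.BirchSwinnertonDyer.BirchSwinnertonDyer.…` repeats the name by design
set_option linter.dupNamespace false

noncomputable section

open scoped Classical

namespace Summit.BirchSwinnertonDyer.BirchSwinnertonDyer.Theorems.AdditiveKoly

open WeierstrassCurve NumberField IsDedekindDomain Field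
  Literature.NumberTheory.EllipticCurves Literature.NumberTheory.EllipticCurves.ModularForms
  Literature.NumberTheory.EllipticCurves.Rank1Residual Literature.NumberTheory.GaloisRepresentations
  Summit.BirchSwinnertonDyer.Rank1Residual Summit.BirchSwinnertonDyer.Rank1Residual.Additive
  Summit.BirchSwinnertonDyer.Rank1Residual.O5

/-! ## §1 Integrality of `log_ω` on `E(ℚ_p)` at an additive `p ≥ 5`, and the divisibility test -/

section Local

variable (W : WeierstrassCurve ℚ) [W.IsElliptic] [W.IsGloballyMinimal] (p : ℕ) [hp : Fact p.Prime]
  {K : Type} [Field K] [NumberField K]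

omit [W.IsGloballyMinimal] in
/-- **`p ∤ c_p` at an additive prime `p ≥ 5`**: the `ℤ_p`-minimal model is not split multiplicative (`Addv`), so
Kodaira–Néron gives `c_p ≤ 4 < p` (`localTamagawaNumber_padic_le_four`), and `c_p ≠ 0`.
[cite: SilvermanATAEC1994, Cor. IV.9.2 (d) (PDF p. 340)] -/
theorem not_dvd_localTamagawaNumber_padic_of_addv_of_five_le' (hp5 : 5 ≤ p) (hadd : Addv W p) :
    ¬ p ∣ (W.baseChange ℚ_[p]).localTamagawaNumber ℤ_[p] := by
  have hns : ¬ ((W.baseChange ℚ_[p]).minimal ℤ_[p]).HasSplitMultiplicativeReduction ℤ_[p] :=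
    fun h ↦ hadd.2 h.toHasMultiplicativeReduction
  have h4 := localTamagawaNumber_padic_le_four p (W.baseChange ℚ_[p]) hns
  have h0 : (W.baseChange ℚ_[p]).localTamagawaNumber ℤ_[p] ≠ 0 :=
    localTamagawaNumber_padic_ne_zero_holds p (W.baseChange ℚ_[p])
  intro hdvd
  have := Nat.le_of_dvd (Nat.pos_of_ne_zero h0) hdvd
  omega

/-- **`log_ω(E(ℚ_p)) ⊆ ℤ_p` at an additive `p ≥ 5`**: by Kim's Lemma 3.10 regime (`range_padicLog_baseChange_of_addv_of_not_dvd`: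
`log(E(ℚ_p)) = p^t ℤ_p`, `t = v_p #E(ℚ_p)_tors ≥ 0`) every value of the `ℤ_p`-linear logarithm has norm `≤ 1`.
[cite: Kim2022StructureSelmer, Lemma 3.10 (PDF pp. 16–17)] [cite: SilvermanAEC2009, IV.6.4, VII.6.3] -/
theorem norm_padicLog_le_one_of_addv (hp5 : 5 ≤ p) (hadd : Addv W p) (Q : (W.baseChange ℚ_[p]).toAffine.Point) :
    ‖LocalLog.padicLog (W.baseChange ℚ_[p]) Q‖ ≤ 1 := by
  have hrange := LocalLog.range_padicLog_baseChange_of_addv_of_not_dvd W p hadd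
    (not_dvd_localTamagawaNumber_padic_of_addv_of_five_le' W p hp5 hadd)
  have hmem : LocalLog.padicLog (W.baseChange ℚ_[p]) Q ∈ (LocalLog.padicLog (W.baseChange ℚ_[p])).range := ⟨Q, rfl⟩
  rw [hrange, Submodule.mem_toAddSubgroup, Submodule.mem_span_singleton] at hmem
  obtain ⟨a, ha⟩ := hmem
  rw [← ha, Algebra.smul_def, PadicInt.algebraMap_apply, norm_mul, norm_pow]
  have ha1 : ‖(a : ℚ_[p])‖ ≤ 1 := a.norm_le_one
  have hp1 : ‖(p : ℚ_[p])‖ ≤ 1 := le_of_lt (Padic.norm_p_lt_one (p := p))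
  exact mul_le_one₀ ha1 (pow_nonneg (norm_nonneg _) _) (pow_le_one₀ (norm_nonneg _) hp1)

/-- **A `p`-divisible point of infinite order has `ord_p log_ω ≥ 1`.** For `P = p·Q` in `E(K)` of infinite order, read in
`E(ℚ_p)` along `ι : K →+* ℚ_p`: `log_ω P_ι = p · log_ω Q_ι` with `log_ω Q_ι ∈ ℤ_p` (§1), so `ord_p log_ω P ≥ 1`
(`padicLogOrd = ord_p ∘ padicLog`, the tree's `padicLogOrd_eq_valuation_padicLog`). [cite: SilvermanAEC2009, IV.6.4, VII.6.3]
[cite: Castella2018, §2.2 (the reading `ord_p log_{ω_E} P`)] -/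
theorem one_le_padicLogOrd_of_zsmul_eq (hp5 : 5 ≤ p) (hadd : Addv W p) (ι : K →+* ℚ_[p])
    {P Q : (W.baseChange K).toAffine.Point} (hPQ : (p : ℤ) • Q = P) (hP : ¬ IsOfFinAddOrder P) :
    1 ≤ padicLogOrd W p ι P := by
  have hmap : X11b.padicPointOf W p ι P = (p : ℤ) • X11b.padicPointOf W p ι Q := by
    simp only [X11b.padicPointOf, ← hPQ, map_zsmul]
  have hPι : ¬ IsOfFinAddOrder (X11b.padicPointOf W p ι P) :=
    HeegnerLogTransport.not_isOfFinAddOrder_padicPointOf W p ι P hP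
  have hQι : ¬ IsOfFinAddOrder (X11b.padicPointOf W p ι Q) := by
    intro h
    apply hPι
    rw [hmap]
    exact h.zsmul
  have hL : LocalLog.padicLog (W.baseChange ℚ_[p]) (X11b.padicPointOf W p ι Q) ≠ 0 :=
    fun h ↦ hQι ((LocalLog.padicLog_eq_zero_iff _ _).mp h)
  have hval : 0 ≤ (LocalLog.padicLog (W.baseChange ℚ_[p]) (X11b.padicPointOf W p ι Q)).valuation :=
    (Padic.norm_le_one_iff_val_nonneg _).mp (norm_padicLog_le_one_of_addv W p hp5 hadd _)
  have hpq : ((p : ℤ) : ℚ_[p]) ≠ 0 := by exact_mod_cast hp.out.ne_zero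
  have hX : padicLogOrd W p ι P = X11b.padicLogOrd W p ι P := rfl
  rw [hX, LocalLog.padicLogOrd_eq_valuation_padicLog W p ι P hPι, hmap, map_zsmul, zsmul_eq_mul,
    Padic.valuation_mul hpq hL, Int.cast_natCast, Padic.valuation_p]
  omega

end Local

/-! ## §2 Kriz–Li's exponent on the additive side, and `ord_p log_ω y_K ≤ 0` from the lender's unit -/

section KrizLi

variable (W : WeierstrassCurve ℚ) [W.IsElliptic] [W.IsGloballyMinimal] (p : ℕ) [hp : Fact p.Prime]

omit [W.IsGloballyMinimal] in
/-- **Kriz–Li's Euler-type exponent is `≥ 0` on the additive side**: `eulerFactorOrd p W G = ∑_{ℓ ∣ pNN′/M} (ord_p|W̃^{ns}(𝔽_ℓ)| − [ℓ = p])`,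
and the `ℓ = p` term is `ord_p p − 1 = 0` because `|W̃^{ns}(𝔽_p)| = p` at an additive `p`; every other term is a valuation.
[cite: KrizLi2019, Thm. 1.16 and Rem. 1.17] -/
theorem eulerFactorOrd_nonneg_of_addv (hadd : Addv W p) (G : WeierstrassCurve ℚ) :
    0 ≤ KrizLi2019.eulerFactorOrd p W G := by
  unfold KrizLi2019.eulerFactorOrd
  refine Finset.sum_nonneg fun ℓ _ ↦ ?_
  by_cases hℓ : ℓ = p
  · subst hℓ
    rw [if_pos rfl, SchneiderFree.nsPointCount_eq_self_of_addv hadd, padicValInt.self hp.out.one_lt]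
    simp
  · rw [if_neg hℓ, sub_zero]
    exact_mod_cast Nat.zero_le _

variable {K : Type} [Field K] [NumberField K]

/-- **`ord_p log_ω y_K ≤ 0` from the LENDER's log-unit, through Kriz–Li Thm. 1.16.** Avatar pair `(E, E₀)` = `(W, W₀)`, both globally
minimal, `E` ADDITIVE at `p`, with a `Γ_ℚ`-equivariant `E[p] ≃ E₀[p]` (so `a_ℓ(E) ≡ a_ℓ(E₀) (mod p)` off `pNN₀`, Kraus–Oesterlé,
PROVED); `K` imaginary quadratic with the Heegner hypothesis for `N` and `N₀`, `p` split, read along `ιp : K →+* ℚ_p`; Heegner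
points `P ∈ E(K)`, `P₀ ∈ E₀(K)` of infinite order realising `heegnerPointComplex Dt H`, `heegnerPointComplex Dt₀ H₀`; `p ∤ c(Dt)`,
`c(Dt₀) ≠ 0`. IF the lender's normalised logarithm is a unit — `ord_p(∏|Ẽ₀^{ns}|/ℓ) + ord_p log_{ω₀} P₀ − ord_p c₀ = 0` — THEN
`ord_p log_ω P ≤ 0`: the registry's valuation corollary transports unit-ness, `ord_p c = 0`, and the `E`-side exponent is `≥ 0`.
CONDITIONAL on `hKL` (named fact, by name). [cite: KrizLi2019, Thm. 1.16 with the sentence after Rem. 1.19]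
[cite: KrausOesterle1992, §3 Prop. 3 (i) ⇒ (iii)] -/
theorem padicLogOrd_le_zero_of_thm116 (hKL : KrizLi2019.thm116_padicLogHeegner_congruence)
    [NeZero (W.conductorNorm ℤ)] (W₀ : WeierstrassCurve ℚ) [W₀.IsElliptic] [W₀.IsGloballyMinimal]
    [NeZero (W₀.conductorNorm ℤ)] (hadd : Addv W p)
    (e : geomTorsion W (p : ℤ) ≃+ geomTorsion W₀ (p : ℤ))
    (he : ∀ (σ : absoluteGaloisGroup ℚ) (T : geomTorsion W (p : ℤ)), e (σ • T) = σ • e T)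
    (Dt : ModularParametrizationData W (W.conductorNorm ℤ)) (Dt₀ : ModularParametrizationData W₀ (W₀.conductorNorm ℤ))
    (hK : IsImaginaryQuadratic K) (hH : SatisfiesHeegnerHypothesis (W.conductorNorm ℤ) K)
    (hH₀ : SatisfiesHeegnerHypothesis (W₀.conductorNorm ℤ) K)
    (hsplit : ((Ideal.span {(p : ℤ)}).primesOver (𝓞 K)).ncard = 2)
    (H : HeegnerDatum (W.conductorNorm ℤ) (NumberField.discr K))
    (H₀ : HeegnerDatum (W₀.conductorNorm ℤ) (NumberField.discr K)) (ι : K →+* ℂ) (ιp : K →+* ℚ_[p])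
    (P : (W.baseChange K).toAffine.Point) (P₀ : (W₀.baseChange K).toAffine.Point)
    (hP : WeierstrassCurve.Affine.Point.map ι.toRatAlgHom P = heegnerPointComplex Dt H)
    (hP₀ : WeierstrassCurve.Affine.Point.map ι.toRatAlgHom P₀ = heegnerPointComplex Dt₀ H₀)
    (hPinf : ¬ IsOfFinAddOrder P) (hP₀inf : ¬ IsOfFinAddOrder P₀)
    (hc : ¬ (p : ℤ) ∣ Dt.c) (hc₀ : Dt₀.c ≠ 0)
    (hunit₀ : KrizLi2019.eulerFactorOrd p W₀ W + padicLogOrd W₀ p ιp P₀ - padicValInt p Dt₀.c = 0) :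
    padicLogOrd W p ιp P ≤ 0 := by
  have hcong : ∀ ℓ : ℕ, ℓ.Prime → ¬ (ℓ ∣ p * W.conductorNorm ℤ * W₀.conductorNorm ℤ) →
      ((W.LFunction ℓ : ℤ) : ZMod p) = ((W₀.LFunction ℓ : ℤ) : ZMod p) :=
    fun ℓ hℓ hnd ↦ KrausOesterle1992.lFunction_congr_of_addEquiv_geomTorsion W W₀ p e he hℓ hnd
  have hcW : Dt.maninConstant ≠ 0 := by
    intro h0
    exact hc (by rw [show Dt.c = Dt.maninConstant from rfl, h0]; exact dvd_zero _)
  have hiff := KrizLi2019.eulerFactorOrd_add_padicLogOrd_sub_eq_zero_iff_of_thm116 p W W₀ hKL hcong Dt Dt₀ K hK hH hH₀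
    hsplit H H₀ ι ιp P P₀ hP hP₀ (HeegnerLogTransport.eulerFactor_ne_zero p W W₀)
    (HeegnerLogTransport.eulerFactor_ne_zero p W₀ W) (HeegnerLogTransport.padicLogOmega_ne_zero W p ιp hPinf)
    (HeegnerLogTransport.padicLogOmega_ne_zero W₀ p ιp hP₀inf) hcW hc₀
  have hW : KrizLi2019.eulerFactorOrd p W W₀ + padicLogOrd W p ιp P - padicValInt p Dt.maninConstant = 0 := hiff.mpr hunit₀
  have hcv : padicValInt p Dt.maninConstant = 0 := padicValInt.eq_zero_of_not_dvd hc
  have hE := eulerFactorOrd_nonneg_of_addv W p hadd W₀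
  rw [hcv] at hW
  push_cast at hW
  omega

end KrizLi

/-! ## §3 The (γ) transfer at conductor one -/

section Transfer

-- `K : Type`: the tree's ring-class class field theory is universe `0` (as in the crux).
variable (W : WeierstrassCurve ℚ) [W.IsElliptic] [W.IsGloballyMinimal] [NeZero (W.conductorNorm ℤ)]
  (p : ℕ) [hp : Fact p.Prime] (K : Type) [Field K] [NumberField K]
  (Dt : ModularParametrizationData W (W.conductorNorm ℤ)) (β : ℤ) (ι : K →+* ℂ)

omit [W.IsGloballyMinimal] hp in
/-- **The Heegner point under `P(1)`, with the FRAME's parametrisation datum by name.** For a conductor-one Kolyvagin–Heegner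
datum `d` on `(Dt, β, ι)`: there are `y_K ∈ E(K)` and a Heegner datum `H` of level `N_E` with `β(H) = β` such that `y_K ↦ P(1)`
in `E(K[1])` (Galois descent, McCallum) and `ι(y_K) = heegnerPointComplex Dt H` (`P(1) = Tr_{K[1]/K} y(1) = ∑_{[𝔞]} Φ(τ_𝔞)`,
Shimura reciprocity — the tree's PROVED `heegnerPointOfConductor_one_galoisConj_holds`). The tree's
`exists_isHeegnerPoint_map_eq_derivedPoint_one` is this statement with `Dt, H, ι` hidden behind `IsHeegnerPoint`.
[cite: GrossLMS1991, §1 (y_K = Tr y₁), §4 (P₁ = y_K)] [cite: Darmon2004, Thm. 3.7] -/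
theorem exists_heegnerPoint_over_derivedPoint_one (hK : IsImaginaryQuadratic K)
    (hH : SatisfiesHeegnerHypothesis (W.conductorNorm ℤ) K) (d : KolyvaginHeegnerData Dt β ι 1) :
    ∃ (P₀ : (W.baseChange K).toAffine.Point) (H : HeegnerDatum (W.conductorNorm ℤ) (NumberField.discr K)),
      WeierstrassCurve.Affine.Point.map (W' := W) (algebraMap K (ringClassField K ι 1)).toRatAlgHom P₀ = d.derivedPoint ∧
      WeierstrassCurve.Affine.Point.map ι.toRatAlgHom P₀ = heegnerPointComplex Dt H := by
  obtain ⟨P₀, hP₀⟩ := McCallum1991.exists_map_eq_derivedPoint_one' hK d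
  obtain ⟨H, hHβ⟩ := exists_heegnerDatum (W.conductorNorm ℤ) hK.discr_neg d.dvd_sq_sub
  obtain ⟨e, he⟩ := heegnerPointOfConductor_one_galoisConj_holds (W.conductorNorm ℤ) W K hK hH Dt β ι d H hHβ
  refine ⟨P₀, H, hP₀, ?_⟩
  have hι : ι.toRatAlgHom = (ringClassField K ι 1).subtype.toRatAlgHom.comp
      (algebraMap K (ringClassField K ι 1)).toRatAlgHom := by
    ext x
    rfl
  rw [hι, ← WeierstrassCurve.Affine.Point.map_map, hP₀, d.derivedPoint_one, map_sum,
    heegnerPointComplex, ← Finset.sum_coe_sort H.reps, ← Finset.sum_coe_sort d.S]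
  exact Fintype.sum_equiv e _ _ fun s ↦ he s

/-- **THE (γ) TRANSFER AT CONDUCTOR ONE** (E-side of sub-row (γ) of stub (A2) `stub_bottomTransfer`, line
`epsilon_matched_retyping`). Frame: `E = W` globally minimal of analytic rank one, ADDITIVE at `p ≥ 5`, `ρ̄_{E,p}` onto, `K`
imaginary quadratic with `d_K < −4`, the Heegner hypothesis for `N_E`, `L(E^{(d_K)}, 1) ≠ 0`, parametrisation datum `Dt` with
`p ∤ c(Dt)`; avatar `E₀ = W₀` globally minimal with a `Γ_ℚ`-equivariant `E[p] ≃ E₀[p]`, the Heegner hypothesis for `N₀`, `p` split in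
`K`, datum `Dt₀` with `c(Dt₀) ≠ 0`. INPUTS BY NAME: Kriz–Li Thm. 1.16 (`hKL`), Gross–Zagier (`hGZ`) and modularity (`hmod`) — so
`y_K` has infinite order. LENDER LOG-UNIT (the `K`-half, a hypothesis): along some `ιp : K →+* ℚ_p`, some Heegner point
`P₀ ∈ E₀(K)` of infinite order realising `heegnerPointComplex Dt₀ H₀` has `ord_p(∏|Ẽ₀^{ns}|/ℓ) + ord_p log_{ω₀} P₀ − ord_p c₀ = 0`.
CONCLUSION: `c_E(1) = d.kolyvaginClass _ 1 ≠ 0` for EVERY conductor-one Kolyvagin–Heegner datum `d` on `(Dt, β, ι)`.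
Proof: §3's `y_K` under `P(1)`; §2 gives `ord_p log_ω y_K ≤ 0`; were `y_K = p·Q` in `E(K)`, §1 would give `≥ 1`; so
`y_K ∉ pE(K)`, i.e. `c(1) ≠ 0` (`kolyvaginClass_one_ne_zero_iff_not_exists_zsmul_eq`). [cite: KrizLi2019, Thm. 1.16, Rem. 1.17]
[cite: GrossLMS1991, §4 (4.4)] [cite: McCallumLMS1991, Cor. 4.5] -/
theorem kolyvaginClass_one_ne_zero_of_thm116 (hKL : KrizLi2019.thm116_padicLogHeegner_congruence)
    (hGZ : gross_zagier (W.conductorNorm ℤ) W K) (hmod : hasEntireLFunction_rat)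
    (hp5 : 5 ≤ p) (hadd : Addv W p) (hs : W.HasSurjectiveModNGaloisRep p) (hr : W.analyticRank = 1)
    (hK : IsImaginaryQuadratic K) (hlt : NumberField.discr K < -4)
    (hH : SatisfiesHeegnerHypothesis (W.conductorNorm ℤ) K)
    (hL : (W.quadraticTwist (NumberField.discr K : ℚ)).entireLFunction 1 ≠ 0) (hc : ¬ (p : ℤ) ∣ Dt.c)
    (W₀ : WeierstrassCurve ℚ) [W₀.IsElliptic] [W₀.IsGloballyMinimal] [NeZero (W₀.conductorNorm ℤ)]
    (e : geomTorsion W (p : ℤ) ≃+ geomTorsion W₀ (p : ℤ))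
    (he : ∀ (σ : absoluteGaloisGroup ℚ) (T : geomTorsion W (p : ℤ)), e (σ • T) = σ • e T)
    (Dt₀ : ModularParametrizationData W₀ (W₀.conductorNorm ℤ)) (hc₀ : Dt₀.c ≠ 0)
    (hH₀ : SatisfiesHeegnerHypothesis (W₀.conductorNorm ℤ) K)
    (hsplit : ((Ideal.span {(p : ℤ)}).primesOver (𝓞 K)).ncard = 2) (ιp : K →+* ℚ_[p])
    (hunit₀ : ∃ (H₀ : HeegnerDatum (W₀.conductorNorm ℤ) (NumberField.discr K)) (P₀ : (W₀.baseChange K).toAffine.Point),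
      WeierstrassCurve.Affine.Point.map ι.toRatAlgHom P₀ = heegnerPointComplex Dt₀ H₀ ∧ ¬ IsOfFinAddOrder P₀ ∧
        KrizLi2019.eulerFactorOrd p W₀ W + padicLogOrd W₀ p ιp P₀ - padicValInt p Dt₀.c = 0)
    (d : KolyvaginHeegnerData Dt β ι 1) :
    d.kolyvaginClass hp.out 1 ≠ 0 := by
  obtain ⟨y, H, hyd, hyH⟩ := exists_heegnerPoint_over_derivedPoint_one W K Dt β ι hK hH d
  obtain ⟨H₀, P₀, hP₀, hP₀inf, hunit⟩ := hunit₀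
  have hyinf : ¬ IsOfFinAddOrder y :=
    X11b.not_isOfFinAddOrder_of_heegner_of_analyticRank_eq_one W (W.conductorNorm ℤ) K Dt H ι y hGZ hmod hr hK hH hL hyH
  have hle : padicLogOrd W p ιp y ≤ 0 :=
    padicLogOrd_le_zero_of_thm116 W p hKL W₀ hadd e he Dt Dt₀ hK hH hH₀ hsplit H H₀ ι ιp y P₀ hyH hP₀ hyinf hP₀inf
      hc hc₀ hunit
  rw [kolyvaginClass_one_ne_zero_iff_not_exists_zsmul_eq W p K Dt β ι hp5 hs hK hlt hH d y hyd]
  rintro ⟨Q, hQ⟩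
  have h1 := one_le_padicLogOrd_of_zsmul_eq W p hp5 hadd ιp hQ hyinf
  omega

/-- **The (γ) transfer in the conclusion shape of `stub_bottomTransfer`** (`∃ m d, d.kolyvaginClass _ 1 ≠ 0`, here with
`m = ∅`): under the hypotheses of `kolyvaginClass_one_ne_zero_of_thm116` and `4N_E ∣ β² − d_K` (so that a conductor-one datum
exists, `nonempty_kolyvaginHeegnerData_one`), SOME Kolyvagin class of `E` is non-zero mod `p` — at conductor `1`.
[cite: KrizLi2019, Thm. 1.16] [cite: GrossLMS1991, §4 (4.4)] [cite: Darmon2004, Thm. 3.6] -/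
theorem exists_kolyvaginClass_ne_zero_of_thm116 (hKL : KrizLi2019.thm116_padicLogHeegner_congruence)
    (hGZ : gross_zagier (W.conductorNorm ℤ) W K) (hmod : hasEntireLFunction_rat)
    (hp5 : 5 ≤ p) (hadd : Addv W p) (hs : W.HasSurjectiveModNGaloisRep p) (hr : W.analyticRank = 1)
    (hK : IsImaginaryQuadratic K) (hlt : NumberField.discr K < -4)
    (hH : SatisfiesHeegnerHypothesis (W.conductorNorm ℤ) K)
    (hL : (W.quadraticTwist (NumberField.discr K : ℚ)).entireLFunction 1 ≠ 0)
    (hβ : (4 * (W.conductorNorm ℤ : ℤ)) ∣ β ^ 2 - NumberField.discr K) (hc : ¬ (p : ℤ) ∣ Dt.c)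
    (W₀ : WeierstrassCurve ℚ) [W₀.IsElliptic] [W₀.IsGloballyMinimal] [NeZero (W₀.conductorNorm ℤ)]
    (e : geomTorsion W (p : ℤ) ≃+ geomTorsion W₀ (p : ℤ))
    (he : ∀ (σ : absoluteGaloisGroup ℚ) (T : geomTorsion W (p : ℤ)), e (σ • T) = σ • e T)
    (Dt₀ : ModularParametrizationData W₀ (W₀.conductorNorm ℤ)) (hc₀ : Dt₀.c ≠ 0)
    (hH₀ : SatisfiesHeegnerHypothesis (W₀.conductorNorm ℤ) K)
    (hsplit : ((Ideal.span {(p : ℤ)}).primesOver (𝓞 K)).ncard = 2) (ιp : K →+* ℚ_[p])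
    (hunit₀ : ∃ (H₀ : HeegnerDatum (W₀.conductorNorm ℤ) (NumberField.discr K)) (P₀ : (W₀.baseChange K).toAffine.Point),
      WeierstrassCurve.Affine.Point.map ι.toRatAlgHom P₀ = heegnerPointComplex Dt₀ H₀ ∧ ¬ IsOfFinAddOrder P₀ ∧
        KrizLi2019.eulerFactorOrd p W₀ W + padicLogOrd W₀ p ιp P₀ - padicValInt p Dt₀.c = 0) :
    ∃ (m : Finset {ℓ // Zhang2014.IsKolyvaginPrime (W.conductorNorm ℤ) W K p ℓ})
      (d : KolyvaginHeegnerData Dt β ι (∏ ℓ ∈ m, (ℓ : ℕ))), d.kolyvaginClass hp.out 1 ≠ 0 := by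
  obtain ⟨d⟩ := nonempty_kolyvaginHeegnerData_one W K Dt β ι hK hβ
  exact ⟨∅, d, kolyvaginClass_one_ne_zero_of_thm116 W p K Dt β ι hKL hGZ hmod hp5 hadd hs hr hK hlt hH hL hc W₀ e he
    Dt₀ hc₀ hH₀ hsplit ιp hunit₀ d⟩

end Transfer

end Summit.BirchSwinnertonDyer.BirchSwinnertonDyer.Theorems.AdditiveKoly

end
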